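import Summits.QuantumFields.YangMills.Theorems.UnitScaleTiltProp7LocMinOfJointRow
import Summits.QuantumFields.YangMills.Theorems.UnitScaleTiltMinimiserStabilityRegPrPV3EChart
import Summits.QuantumFields.YangMills.Theorems.UnitScaleTiltProp7SPrintIn19Dict
import HarnessLib

/-!
# Route `UnitScaleTilt`, crux K1 child «MinimiserStabilityRegPr» (stmt-QuantumFields-19200) — THE α-P LANE'S SINGLE JUNCTION, BY NAME:
# the EX knit of record v3.1ˢ (✓`Prop7StubEXOfChartPiecesTwS4`, ★w2-19200 g4) displays ONE growth row `hcoW`; this file proves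
# **`hcoW` ⇐ JOINT_W** — the joint row (✓∕⧗`Prop7LocMinOfJointRow`) supplied at the E–L-critical chart background `W` for the chart direction `η·A`.

Cell `ym3-torus`, width seat `ym-ust-19200-w4` (gen 4).  THEOREMS ONLY (0 `def`, 0 `sorry`).  YM₃ on T³ is a ladder rung (R3), not the Clay problem; nothing here
claims the stub, the crux, d = 4 or the mass gap.

WHAT IS PROVED (ns `…Theorems.Prop7HcoWOfJointRows`).  ★★★ `hcoW_of_linRowsW` (the Lin-level socket: sup-radius + `|ℓ_W(ηA)| + (15552s² + 216·regThreshold(e))·Σ‖ηA‖² ≤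
¼·Σ_p‖ℒ_p(ηA)‖²` ⟹ `hcoW`, no criticality used) and ★★★ `hcoW_of_jointRowsW`: HYPOTHESIS = the binder prefix of `hcoW` VERBATIM (member, radii, `W ∈ (6)(e) ∩ 𝔅_k(V)`,
the E–L clause over `𝔅_k(V)`, `RestrictedPrint`, the self-adjoint chart coordinate `A` with `U₁ = e^{iηA}`, (136)∕(138)∕(139), the gauge-moved competitor in
(6)(e)) concluding, instead of the action inequality, the JOINT_W data for the direction `D := η·A`: a sup-radius `s` with `4s ≤ 1`, a curve `γ` through `W` with
bond velocities `ξ`, a differentiable gauge lift `u′` into `𝔅_k(V)` with `u′(0) = 1`, and the joint row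
`e·ℓ⁻³·Σ_b‖iηA(b) − ξ(b)‖ + (15552s² + 216·regThreshold(e))·Σ‖ηA‖² ≤ ¼·Σ_p‖ℒ_p(ηA)‖²`; CONCLUSION = `hcoW` VERBATIM.  Proof: `D = η·A` is Hermitian (`A` self-adjoint,
`η` real) and traceless (`e^{iηA(b)} = U₁(b) ∈ SU(2)` with `‖ηA(b)‖ ≤ s ≤ ¼`, ✓`Prop7SPrintIn19.trace_eq_zero_of_exp_mem_SU2`), so `U₁ = expHermField(η·A)` and
✓`Prop7LocMinOfJointRow.wilsonAction4_le_expChart_of_jointRow_stat` with `T := {η·A}` is the claim.  With it, EX v3.1ˢ reads: CHART_W pieces (✓) ∧ `hThm2` (T2 socket) ∧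
a JOINT_W supplier ⟹ `stub_existenceMinimalOrbit`.

HONEST SCOPE.  Bookkeeping; the JOINT_W supplier is displayed, not proved ((142)'s content); (136)∕(138)∕(139) and `RestrictedPrint` are carried, unused, so that the
text is `hcoW`'s.  `--supports stmt-QuantumFields-19200`, count-neutral.

References: T. Bałaban, CMP 102 (1985) 277–309 [Balaban1985Variational] ((2), (6) p.278, (19) p.281, (47)–(49) pp.285–286, (112) p.294, (116) p.295, (136)–(142) pp.298–299,
Prop. 7 p.299); CMP 99 (1985) 75–102 [Balaban1985RegularSpaces] (Thm 2 p.83).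
-/

set_option autoImplicit false
noncomputable section

open scoped BigOperators Matrix.Norms.L2Operator Matrix Topology
open Filter NormedSpace

namespace Summit.QuantumFields.YangMills.Theorems.Prop7HcoWOfJointRows

open Literature.MathematicalPhysics.QuantumFieldTheory.Balaban1983to89
open Literature.MathematicalPhysics.QuantumFieldTheory.Balaban1983to89.T3ContinuumYM3Torus
open Literature.MathematicalPhysics.QuantumFieldTheory.Balaban1983to89.T3UnitLawDensityEML (ℰp)
open Literature.MathematicalPhysics.QuantumFieldTheory.Balaban1983to89.T3ConstrainedMinimiser (fibre)
open Literature.MathematicalPhysics.QuantumFieldTheory.Balaban1983to89.T3PrintedRegularMinimiser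
open Literature.MathematicalPhysics.QuantumFieldTheory.Balaban1983to89.T3RegularMinimiser
open Literature.MathematicalPhysics.QuantumFieldTheory.Balaban1983to89.T3Thm1Carrier
open B10Eq27TorusAxialLog (pull)
open T3SectALandauChart (emb15 eta bgUnits)
open Summit.QuantumFields.YangMills.Theorems.Prop7SPrint (basePt RestrictedPrint)
open Summit.QuantumFields.YangMills.Theorems.Prop7TPrint (expHerm expHermField expHermField_apply coe_expHerm)
open Summit.QuantumFields.YangMills.Theorems.Prop7SPrintIn19 (trace_eq_zero_of_exp_mem_SU2)
open Summit.QuantumFields.YangMills.Theorems.Prop7LocMinOfJointRow (wilsonAction4_le_expChart_of_jointRow_stat wilsonAction4_le_expChart_of_linRow)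

/-- `η·A(b)` is Hermitian and traceless when `A(b)` is self-adjoint and `e^{iηA(b)}` is special unitary with `‖ηA(b)‖ ≤ 1`. [cite: Balaban1985Variational, (112) p.294, (47) p.285] -/
theorem herm_tr_of_selfAdjoint_of_exp_mem {η : ℝ} {X : Matrix (Fin 2) (Fin 2) ℂ} (hX : IsSelfAdjoint X)
    (hmem : exp (Complex.I • (η • X)) ∈ Matrix.specialUnitaryGroup (Fin 2) ℂ) (hn : ‖η • X‖ ≤ 1) :
    (η • X).IsHermitian ∧ Matrix.trace (η • X) = 0 :=
  ⟨(IsSelfAdjoint.all η).smul hX, trace_eq_zero_of_exp_mem_SU2 hmem hn⟩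

/-- ★★★ **`hcoW` OF THE EX KNIT v3.1ˢ FROM A JOINT_W SUPPLIER.**  See the module docstring: hypothesis = `hcoW`'s binder prefix verbatim concluding the JOINT_W data for
`D := η·A`; conclusion = `hcoW` verbatim. [cite: Balaban1985Variational, (141)-(142) p.299, (47)-(49) pp.285-286, (112) p.294, (116) p.295, (136)-(139) pp.298-299, (2), (6) p.278] -/
theorem hcoW_of_jointRowsW
    (hJW : ∀ (L : ℕ), 1 < L → ∀ (B₁ : ℝ), 0 < B₁ → ∃ e₇ c₇ : ℝ, 0 < e₇ ∧ 0 < c₇ ∧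
      ∀ (F : T3Family), F.L = L → ∀ (n K : ℕ) (hnK : n < K) (e α : ℝ) (V : GaugeField (F.P n) 0 (Matrix.specialUnitaryGroup (Fin 2) ℂ))
        (W U₁ : GaugeField (F.P K) 0 (Matrix.specialUnitaryGroup (Fin 2) ℂ)) (u : GaugeTransf (F.P K) 0 (Matrix.specialUnitaryGroup (Fin 2) ℂ))
        (A : PBond (F.P K) 0 → Matrix (Fin 2) (Fin 2) ℂ),
        0 < e → e ≤ e₇ → 0 < α → α ≤ c₇ → W ∈ regFibrePr F n K hnK.le e V →
        (∀ γ : ℝ → GaugeField (F.P K) 0 (Matrix.specialUnitaryGroup (Fin 2) ℂ), γ 0 = W → (∀ t, γ t ∈ fibre F ℰp n K hnK.le V) →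
          (∀ b, DifferentiableAt ℝ (fun t => ((γ t b : Matrix.specialUnitaryGroup (Fin 2) ℂ) : Matrix (Fin 2) (Fin 2) ℂ)) 0) →
            deriv (fun t => wilsonAction4 (γ t)) 0 = 0) →
        RestrictedPrint F n K W u → (∀ b : PBond (F.P K) 0, IsSelfAdjoint (A b)) →
        (∀ b : PBond (F.P K) 0, ((U₁ b : Matrix.specialUnitaryGroup (Fin 2) ℂ) : Matrix (Fin 2) (Fin 2) ℂ) = exp (Complex.I • ((eta F n K) • A b))) →
        (∃ (β₀ B₂ : ℝ) (len : B7Prop1Explicit.Site (F.P K).d → ℝ),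
          B8Thm2TorusAt.C136T (F.P K).L (K - n) (eta F n K) β₀ B₁ B₂ len α (pull (bgUnits F K W) (basePt F n K)) (pull A (basePt F n K))) →
        B8Eq138LandauZd.IsLandau138 (F.P K).L (K - n) (eta F n K) (Set.univ : Set (B7Prop1Explicit.Site (F.P K).d)) (B8Thm4TorusAt.torusLam (K - n))
          (pull (bgUnits F K W) (basePt F n K)) (pull A (basePt F n K)) →
        B8Thm2TorusAt.C139T (F.P K).L (K - n) (eta F n K) B₁ α (pull (bgUnits F K W) (basePt F n K)) (pull A (basePt F n K)) →
        GaugeField.gaugeAct u (emb15 W U₁) ∈ regFibrePr F n K hnK.le e V →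
          ∃ (s : ℝ) (γ : ℝ → GaugeField (F.P K) 0 (Matrix.specialUnitaryGroup (Fin 2) ℂ)) (ξ : PBond (F.P K) 0 → Matrix (Fin 2) (Fin 2) ℂ) (u' : ℝ → GaugeTransf (F.P K) 0 (Matrix.specialUnitaryGroup (Fin 2) ℂ)),
            (∀ b : PBond (F.P K) 0, ‖(eta F n K • A) b‖ ≤ s) ∧ 4 * s ≤ 1 ∧
            γ 0 = W ∧ (∀ b : PBond (F.P K) 0, HasDerivAt (fun t : ℝ => (γ t b : Matrix (Fin 2) (Fin 2) ℂ) * star (W b : Matrix (Fin 2) (Fin 2) ℂ)) (ξ b) 0) ∧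
            u' 0 = (fun _ => 1) ∧ (∀ t, GaugeField.gaugeAct (u' t) (γ t) ∈ fibre F ℰp n K hnK.le V) ∧
            (∀ b : PBond (F.P K) 0, DifferentiableAt ℝ (fun t => ((GaugeField.gaugeAct (u' t) (γ t) b : Matrix.specialUnitaryGroup (Fin 2) ℂ) : Matrix (Fin 2) (Fin 2) ℂ)) 0) ∧
            e * (((F.L : ℝ) ^ (K - n)) ^ 3)⁻¹ * ∑ b : PBond (F.P K) 0, ‖Complex.I • (eta F n K • A) b - ξ b‖
              + (15552 * s ^ 2 + 216 * regThreshold F n K e) * ∑ b : PBond (F.P K) 0, ‖(eta F n K • A) b‖ ^ 2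
            ≤ 1 / 4 * ∑ p : Plaq (F.P K) 0, ‖((Complex.I • (eta F n K • A) ⟨p.src, p.μ⟩) + ((W ⟨p.src, p.μ⟩ : Matrix (Fin 2) (Fin 2) ℂ) * (Complex.I • (eta F n K • A) ⟨p.src.shift p.μ, p.ν⟩) * star (W ⟨p.src, p.μ⟩ : Matrix (Fin 2) (Fin 2) ℂ))
            - (((W ⟨p.src, p.μ⟩ * W ⟨p.src.shift p.μ, p.ν⟩ * (W ⟨p.src.shift p.ν, p.μ⟩)⁻¹ : Matrix.specialUnitaryGroup (Fin 2) ℂ) : Matrix (Fin 2) (Fin 2) ℂ) * (Complex.I • (eta F n K • A) ⟨p.src.shift p.ν, p.μ⟩) * star ((W ⟨p.src, p.μ⟩ * W ⟨p.src.shift p.μ, p.ν⟩ * (W ⟨p.src.shift p.ν, p.μ⟩)⁻¹ : Matrix.specialUnitaryGroup (Fin 2) ℂ) : Matrix (Fin 2) (Fin 2) ℂ))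
            - (((GaugeField.plaqHol W p : Matrix.specialUnitaryGroup (Fin 2) ℂ) : Matrix (Fin 2) (Fin 2) ℂ) * (Complex.I • (eta F n K • A) ⟨p.src, p.ν⟩) * star ((GaugeField.plaqHol W p : Matrix.specialUnitaryGroup (Fin 2) ℂ) : Matrix (Fin 2) (Fin 2) ℂ)))‖ ^ 2) :
    ∀ (L : ℕ), 1 < L → ∀ (B₁ : ℝ), 0 < B₁ → ∃ e₇ c₇ : ℝ, 0 < e₇ ∧ 0 < c₇ ∧
      ∀ (F : T3Family), F.L = L → ∀ (n K : ℕ) (hnK : n < K) (e α : ℝ) (V : GaugeField (F.P n) 0 (Matrix.specialUnitaryGroup (Fin 2) ℂ))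
        (W U₁ : GaugeField (F.P K) 0 (Matrix.specialUnitaryGroup (Fin 2) ℂ)) (u : GaugeTransf (F.P K) 0 (Matrix.specialUnitaryGroup (Fin 2) ℂ))
        (A : PBond (F.P K) 0 → Matrix (Fin 2) (Fin 2) ℂ),
        0 < e → e ≤ e₇ → 0 < α → α ≤ c₇ → W ∈ regFibrePr F n K hnK.le e V →
        (∀ γ : ℝ → GaugeField (F.P K) 0 (Matrix.specialUnitaryGroup (Fin 2) ℂ), γ 0 = W → (∀ t, γ t ∈ fibre F ℰp n K hnK.le V) →
          (∀ b, DifferentiableAt ℝ (fun t => ((γ t b : Matrix.specialUnitaryGroup (Fin 2) ℂ) : Matrix (Fin 2) (Fin 2) ℂ)) 0) →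
            deriv (fun t => wilsonAction4 (γ t)) 0 = 0) →
        RestrictedPrint F n K W u → (∀ b : PBond (F.P K) 0, IsSelfAdjoint (A b)) →
        (∀ b : PBond (F.P K) 0, ((U₁ b : Matrix.specialUnitaryGroup (Fin 2) ℂ) : Matrix (Fin 2) (Fin 2) ℂ) = exp (Complex.I • ((eta F n K) • A b))) →
        (∃ (β₀ B₂ : ℝ) (len : B7Prop1Explicit.Site (F.P K).d → ℝ),
          B8Thm2TorusAt.C136T (F.P K).L (K - n) (eta F n K) β₀ B₁ B₂ len α (pull (bgUnits F K W) (basePt F n K)) (pull A (basePt F n K))) →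
        B8Eq138LandauZd.IsLandau138 (F.P K).L (K - n) (eta F n K) (Set.univ : Set (B7Prop1Explicit.Site (F.P K).d)) (B8Thm4TorusAt.torusLam (K - n))
          (pull (bgUnits F K W) (basePt F n K)) (pull A (basePt F n K)) →
        B8Thm2TorusAt.C139T (F.P K).L (K - n) (eta F n K) B₁ α (pull (bgUnits F K W) (basePt F n K)) (pull A (basePt F n K)) →
        GaugeField.gaugeAct u (emb15 W U₁) ∈ regFibrePr F n K hnK.le e V →
          wilsonAction4 W ≤ wilsonAction4 (emb15 W U₁) := by
  intro L hL B₁ hB₁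
  obtain ⟨e₇, c₇, he₇, hc₇, H⟩ := hJW L hL B₁ hB₁
  refine ⟨e₇, c₇, he₇, hc₇, ?_⟩
  intro F hF n K hnK e α V W U₁ u A he heε hα hαc hWreg hEL hRP hA hU₁ h136 h138 h139 hmem
  obtain ⟨s, γ, ξ, u', hDs, hs4, hγ0, hγξ, hu0, hufib, hudiff, hJ⟩ :=
    H F hF n K hnK e α V W U₁ u A he heε hα hαc hWreg hEL hRP hA hU₁ h136 h138 h139 hmem
  -- the direction `D := η·A` is Hermitian-traceless, so `U₁ = expHermField (η·A)`
  have hDh : ∀ b : PBond (F.P K) 0, ((eta F n K • A) b).IsHermitian ∧ Matrix.trace ((eta F n K • A) b) = 0 := fun b => by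
    have hmemb : exp (Complex.I • ((eta F n K) • A b)) ∈ Matrix.specialUnitaryGroup (Fin 2) ℂ := hU₁ b ▸ (U₁ b).prop
    exact herm_tr_of_selfAdjoint_of_exp_mem (hA b) hmemb ((hDs b).trans (by linarith))
  have hU₁eq : U₁ = expHermField (eta F n K • A) := by
    funext b
    apply Subtype.ext
    rw [hU₁ b, expHermField_apply, coe_expHerm (hDh b)]
    rfl
  have hreg : RegPr F n K e W := ((mem_regFibrePr_iff F).mp hWreg).2
  have key := wilsonAction4_le_expChart_of_jointRow_stat F hnK.le V hEL hreg {(eta F n K • A)}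
    (fun D hD => by
      rw [Set.mem_singleton_iff] at hD
      subst hD
      exact ⟨hDh, s, γ, ξ, u', hDs, hs4, hγ0, hγξ, hu0, hufib, hudiff, hJ⟩)
    (eta F n K • A) (Set.mem_singleton _)
  rw [hU₁eq]
  exact key

/-- ★★★ **`hcoW` OF THE EX KNIT v3.1ˢ FROM A Lin-LEVEL SUPPLIER** (the most permissive socket): hypothesis = `hcoW`'s binder prefix verbatim concluding, for the direction
`η·A`, a sup-radius `s` (`4s ≤ 1`) and the Lin-level row `|ℓ_W(ηA)| + (15552s² + 216·regThreshold(e))·Σ‖ηA‖² ≤ ¼·Σ_p‖ℒ_p(ηA)‖²` of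
✓∕⧗`Prop7LocMinOfJointRow.wilsonAction4_le_expChart_of_linRow` (how `|ℓ_W(ηA)|` is bounded — E–L clause + curve currency, or the `Q`-currency of
✓`Prop7FirstVariationExactPairing` — is the supplier's business); conclusion = `hcoW` verbatim. [cite: Balaban1985Variational, (141)-(142) p.299, (47)-(49) pp.285-286, (112) p.294, (116) p.295, (6) p.278] -/
theorem hcoW_of_linRowsW
    (hLW : ∀ (L : ℕ), 1 < L → ∀ (B₁ : ℝ), 0 < B₁ → ∃ e₇ c₇ : ℝ, 0 < e₇ ∧ 0 < c₇ ∧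
      ∀ (F : T3Family), F.L = L → ∀ (n K : ℕ) (hnK : n < K) (e α : ℝ) (V : GaugeField (F.P n) 0 (Matrix.specialUnitaryGroup (Fin 2) ℂ))
        (W U₁ : GaugeField (F.P K) 0 (Matrix.specialUnitaryGroup (Fin 2) ℂ)) (u : GaugeTransf (F.P K) 0 (Matrix.specialUnitaryGroup (Fin 2) ℂ))
        (A : PBond (F.P K) 0 → Matrix (Fin 2) (Fin 2) ℂ),
        0 < e → e ≤ e₇ → 0 < α → α ≤ c₇ → W ∈ regFibrePr F n K hnK.le e V →
        (∀ γ : ℝ → GaugeField (F.P K) 0 (Matrix.specialUnitaryGroup (Fin 2) ℂ), γ 0 = W → (∀ t, γ t ∈ fibre F ℰp n K hnK.le V) →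
          (∀ b, DifferentiableAt ℝ (fun t => ((γ t b : Matrix.specialUnitaryGroup (Fin 2) ℂ) : Matrix (Fin 2) (Fin 2) ℂ)) 0) →
            deriv (fun t => wilsonAction4 (γ t)) 0 = 0) →
        RestrictedPrint F n K W u → (∀ b : PBond (F.P K) 0, IsSelfAdjoint (A b)) →
        (∀ b : PBond (F.P K) 0, ((U₁ b : Matrix.specialUnitaryGroup (Fin 2) ℂ) : Matrix (Fin 2) (Fin 2) ℂ) = exp (Complex.I • ((eta F n K) • A b))) →
        (∃ (β₀ B₂ : ℝ) (len : B7Prop1Explicit.Site (F.P K).d → ℝ),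
          B8Thm2TorusAt.C136T (F.P K).L (K - n) (eta F n K) β₀ B₁ B₂ len α (pull (bgUnits F K W) (basePt F n K)) (pull A (basePt F n K))) →
        B8Eq138LandauZd.IsLandau138 (F.P K).L (K - n) (eta F n K) (Set.univ : Set (B7Prop1Explicit.Site (F.P K).d)) (B8Thm4TorusAt.torusLam (K - n))
          (pull (bgUnits F K W) (basePt F n K)) (pull A (basePt F n K)) →
        B8Thm2TorusAt.C139T (F.P K).L (K - n) (eta F n K) B₁ α (pull (bgUnits F K W) (basePt F n K)) (pull A (basePt F n K)) →
        GaugeField.gaugeAct u (emb15 W U₁) ∈ regFibrePr F n K hnK.le e V →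
          ∃ s : ℝ, (∀ b : PBond (F.P K) 0, ‖(eta F n K • A) b‖ ≤ s) ∧ 4 * s ≤ 1 ∧
            |∑ p : Plaq (F.P K) 0, (1 / 2) * (((((GaugeField.plaqHol W p : Matrix.specialUnitaryGroup (Fin 2) ℂ) : Matrix (Fin 2) (Fin 2) ℂ) - 1)ᴴ * (((Complex.I • (eta F n K • A) ⟨p.src, p.μ⟩) + ((W ⟨p.src, p.μ⟩ : Matrix (Fin 2) (Fin 2) ℂ) * (Complex.I • (eta F n K • A) ⟨p.src.shift p.μ, p.ν⟩) * star (W ⟨p.src, p.μ⟩ : Matrix (Fin 2) (Fin 2) ℂ))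
            - (((W ⟨p.src, p.μ⟩ * W ⟨p.src.shift p.μ, p.ν⟩ * (W ⟨p.src.shift p.ν, p.μ⟩)⁻¹ : Matrix.specialUnitaryGroup (Fin 2) ℂ) : Matrix (Fin 2) (Fin 2) ℂ) * (Complex.I • (eta F n K • A) ⟨p.src.shift p.ν, p.μ⟩) * star ((W ⟨p.src, p.μ⟩ * W ⟨p.src.shift p.μ, p.ν⟩ * (W ⟨p.src.shift p.ν, p.μ⟩)⁻¹ : Matrix.specialUnitaryGroup (Fin 2) ℂ) : Matrix (Fin 2) (Fin 2) ℂ))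
            - (((GaugeField.plaqHol W p : Matrix.specialUnitaryGroup (Fin 2) ℂ) : Matrix (Fin 2) (Fin 2) ℂ) * (Complex.I • (eta F n K • A) ⟨p.src, p.ν⟩) * star ((GaugeField.plaqHol W p : Matrix.specialUnitaryGroup (Fin 2) ℂ) : Matrix (Fin 2) (Fin 2) ℂ))) * ((GaugeField.plaqHol W p : Matrix.specialUnitaryGroup (Fin 2) ℂ) : Matrix (Fin 2) (Fin 2) ℂ))).trace).re|
                + (15552 * s ^ 2 + 216 * regThreshold F n K e) * ∑ b : PBond (F.P K) 0, ‖(eta F n K • A) b‖ ^ 2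
              ≤ 1 / 4 * ∑ p : Plaq (F.P K) 0, ‖((Complex.I • (eta F n K • A) ⟨p.src, p.μ⟩) + ((W ⟨p.src, p.μ⟩ : Matrix (Fin 2) (Fin 2) ℂ) * (Complex.I • (eta F n K • A) ⟨p.src.shift p.μ, p.ν⟩) * star (W ⟨p.src, p.μ⟩ : Matrix (Fin 2) (Fin 2) ℂ))
            - (((W ⟨p.src, p.μ⟩ * W ⟨p.src.shift p.μ, p.ν⟩ * (W ⟨p.src.shift p.ν, p.μ⟩)⁻¹ : Matrix.specialUnitaryGroup (Fin 2) ℂ) : Matrix (Fin 2) (Fin 2) ℂ) * (Complex.I • (eta F n K • A) ⟨p.src.shift p.ν, p.μ⟩) * star ((W ⟨p.src, p.μ⟩ * W ⟨p.src.shift p.μ, p.ν⟩ * (W ⟨p.src.shift p.ν, p.μ⟩)⁻¹ : Matrix.specialUnitaryGroup (Fin 2) ℂ) : Matrix (Fin 2) (Fin 2) ℂ))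
            - (((GaugeField.plaqHol W p : Matrix.specialUnitaryGroup (Fin 2) ℂ) : Matrix (Fin 2) (Fin 2) ℂ) * (Complex.I • (eta F n K • A) ⟨p.src, p.ν⟩) * star ((GaugeField.plaqHol W p : Matrix.specialUnitaryGroup (Fin 2) ℂ) : Matrix (Fin 2) (Fin 2) ℂ)))‖ ^ 2) :
    ∀ (L : ℕ), 1 < L → ∀ (B₁ : ℝ), 0 < B₁ → ∃ e₇ c₇ : ℝ, 0 < e₇ ∧ 0 < c₇ ∧
      ∀ (F : T3Family), F.L = L → ∀ (n K : ℕ) (hnK : n < K) (e α : ℝ) (V : GaugeField (F.P n) 0 (Matrix.specialUnitaryGroup (Fin 2) ℂ))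
        (W U₁ : GaugeField (F.P K) 0 (Matrix.specialUnitaryGroup (Fin 2) ℂ)) (u : GaugeTransf (F.P K) 0 (Matrix.specialUnitaryGroup (Fin 2) ℂ))
        (A : PBond (F.P K) 0 → Matrix (Fin 2) (Fin 2) ℂ),
        0 < e → e ≤ e₇ → 0 < α → α ≤ c₇ → W ∈ regFibrePr F n K hnK.le e V →
        (∀ γ : ℝ → GaugeField (F.P K) 0 (Matrix.specialUnitaryGroup (Fin 2) ℂ), γ 0 = W → (∀ t, γ t ∈ fibre F ℰp n K hnK.le V) →
          (∀ b, DifferentiableAt ℝ (fun t => ((γ t b : Matrix.specialUnitaryGroup (Fin 2) ℂ) : Matrix (Fin 2) (Fin 2) ℂ)) 0) →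
            deriv (fun t => wilsonAction4 (γ t)) 0 = 0) →
        RestrictedPrint F n K W u → (∀ b : PBond (F.P K) 0, IsSelfAdjoint (A b)) →
        (∀ b : PBond (F.P K) 0, ((U₁ b : Matrix.specialUnitaryGroup (Fin 2) ℂ) : Matrix (Fin 2) (Fin 2) ℂ) = exp (Complex.I • ((eta F n K) • A b))) →
        (∃ (β₀ B₂ : ℝ) (len : B7Prop1Explicit.Site (F.P K).d → ℝ),
          B8Thm2TorusAt.C136T (F.P K).L (K - n) (eta F n K) β₀ B₁ B₂ len α (pull (bgUnits F K W) (basePt F n K)) (pull A (basePt F n K))) →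
        B8Eq138LandauZd.IsLandau138 (F.P K).L (K - n) (eta F n K) (Set.univ : Set (B7Prop1Explicit.Site (F.P K).d)) (B8Thm4TorusAt.torusLam (K - n))
          (pull (bgUnits F K W) (basePt F n K)) (pull A (basePt F n K)) →
        B8Thm2TorusAt.C139T (F.P K).L (K - n) (eta F n K) B₁ α (pull (bgUnits F K W) (basePt F n K)) (pull A (basePt F n K)) →
        GaugeField.gaugeAct u (emb15 W U₁) ∈ regFibrePr F n K hnK.le e V →
          wilsonAction4 W ≤ wilsonAction4 (emb15 W U₁) := by
  intro L hL B₁ hB₁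
  obtain ⟨e₇, c₇, he₇, hc₇, H⟩ := hLW L hL B₁ hB₁
  refine ⟨e₇, c₇, he₇, hc₇, ?_⟩
  intro F hF n K hnK e α V W U₁ u A he heε hα hαc hWreg hEL hRP hA hU₁ h136 h138 h139 hmem
  obtain ⟨s, hDs, hs4, hlin⟩ := H F hF n K hnK e α V W U₁ u A he heε hα hαc hWreg hEL hRP hA hU₁ h136 h138 h139 hmem
  have hDh : ∀ b : PBond (F.P K) 0, ((eta F n K • A) b).IsHermitian ∧ Matrix.trace ((eta F n K • A) b) = 0 := fun b => by
    have hmemb : exp (Complex.I • ((eta F n K) • A b)) ∈ Matrix.specialUnitaryGroup (Fin 2) ℂ := hU₁ b ▸ (U₁ b).prop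
    exact herm_tr_of_selfAdjoint_of_exp_mem (hA b) hmemb ((hDs b).trans (by linarith))
  have hU₁eq : U₁ = expHermField (eta F n K • A) := by
    funext b
    apply Subtype.ext
    rw [hU₁ b, expHermField_apply, coe_expHerm (hDh b)]
    rfl
  have hreg : RegPr F n K e W := ((mem_regFibrePr_iff F).mp hWreg).2
  rw [hU₁eq]
  exact wilsonAction4_le_expChart_of_linRow F hreg (eta F n K • A) hDh hDs hs4 hlin

end Summit.QuantumFields.YangMills.Theorems.Prop7HcoWOfJointRows

end
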